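import Mathlib
import Summits.Ventures.PercRepro2.BHKAvoid
import Summits.Ventures.PercRepro2.BHKEvents
import Summits.Ventures.PercRepro2.VdBKahn
import Summits.Ventures.PercRepro2.SideBridge
import Summits.Ventures.PercRepro2.PendantBSideBound

/-!
# The cross-covariance of a product event: `−Cov_Q(1_{u∈C₂}1_{o∈C₂}, 1_{b∈C₁}) ≤ −Cov_Q(1_{o∈C₂}, 1_{b∈C₁}) − P_Q(o∈C₂)·Cov_Q(1_{u∈C₂}, 1_{b∈C₁})`
(blind cell PercRepro2, mine-2 g56, 2026-08-30; `conjectures/MINE-2.md` M2-122)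

With `Q = {a₁ ↮ a₂}`, `hv = {v ∈ C(a₂)}`, `lb = {b ∈ C(a₁)}` and the cleared masses `P = P(Q)`,
`Hu = P(Q, hu)`, `Ho = P(Q, ho)`, `Lb = P(Q, lb)`, `HoLb = P(Q, ho, lb)`, `HuLb = P(Q, hu, lb)`,
`HuHo = P(Q, hu, ho)`, `HuHoLb = P(Q, hu, ho, lb)`, the **one-copy inequality**

  **`cross_product_bound`**:
  `0 ≤ P·(Lb·Ho − P·HoLb) + Ho·(Lb·Hu − P·HuLb) − P·(HuHo·Lb − P·HuHoLb)`

for every weight vector, i.e. (when `P(Q) > 0`)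

  `Cr(b; uo) ≤ Cr(b, o) + P_Q(o ∈ C₂)·Cr(b, u)`,  `Cr(b; S) := −Cov_Q(1_{S ⊆ C₂}, 1_{b ∈ C₁})`:

the negative cross correlation of the PRODUCT event `{u, o ∈ C(a₂)}` with `{b ∈ C(a₁)}` is at most
the cross correlation of `{o ∈ C(a₂)}` plus `P_Q(o ∈ C₂)` times the cross correlation of
`{u ∈ C(a₂)}`.  The mirror (`a₁ ↔ a₂`) is the candidate `(K1)` of M2-120 (g55; 0 violations in
4,248 climbs), here a theorem.  PROOF: BHK06 Thm 1.4 with the AVOIDED SET `X = {a₁, u}`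
(`bhk_cross_cluster_avoid`, `s = a₂`): on `R = {a₂ ↮ a₁, a₂ ↮ u}` the events `ho` and `lb` are
negatively correlated, `(HoLb − HuHoLb)·(P − Hu) ≤ (Ho − HuHo)·(Lb − HuLb)`; BHK06 Thm 1.3 (same
cluster, `bhk_same_cluster_events`): `Ho·Hu ≤ HuHo·P`; BHK 1.4 on the whole graph
(`cross_whole_mirror`): `P·HuLb ≤ Lb·Hu`; and the algebraic identity
`(P − Hu)·[target] = P²·[(Ho − HuHo)(Lb − HuLb) − (HoLb − HuHoLb)(P − Hu)] + (Lb·Hu − P·HuLb)·(HuHo·P − Ho·Hu)`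
(`key_ineq`) closes the case `P > Hu`, while `P = Hu` forces every `R`-mass to vanish.
At `u = b` this is the mirror of `same_side_le_cross` (M2-118).  Own work; standard axioms.
-/

namespace Summit.Ventures.PercRepro2

namespace CovForm

namespace CrossProduct

/-! ## The algebraic core -/

section Algebra

variable {R : Type*} [Field R] [LinearOrder R] [IsStrictOrderedRing R]

/-- **The algebraic core**: from the avoided-set BHK inequality
`(HoLb − HuHoLb)(P − Hu) ≤ (Ho − HuHo)(Lb − HuLb)`, the same-cluster inequality `Ho·Hu ≤ HuHo·P` and
the cross inequality `P·HuLb ≤ Lb·Hu`, with the `R`-masses `Ho − HuHo`, `Lb − HuLb`, `HoLb − HuHoLb`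
between `0` and `P − Hu ≥ 0`:
`0 ≤ P(Lb·Ho − P·HoLb) + Ho(Lb·Hu − P·HuLb) − P(HuHo·Lb − P·HuHoLb)`. -/
lemma key_ineq {P Hu Ho Lb HoLb HuLb HuHo HuHoLb : R}
    (hA : 0 ≤ P - Hu) (hB0 : 0 ≤ Ho - HuHo) (hBA : Ho - HuHo ≤ P - Hu)
    (hC0 : 0 ≤ Lb - HuLb) (hCA : Lb - HuLb ≤ P - Hu)
    (hD0 : 0 ≤ HoLb - HuHoLb) (hDA : HoLb - HuHoLb ≤ P - Hu)
    (hstar : (HoLb - HuHoLb) * (P - Hu) ≤ (Ho - HuHo) * (Lb - HuLb))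
    (hH : Ho * Hu ≤ HuHo * P) (hcross : P * HuLb ≤ Lb * Hu) :
    0 ≤ P * (Lb * Ho - P * HoLb) + Ho * (Lb * Hu - P * HuLb) -
      P * (HuHo * Lb - P * HuHoLb) := by
  rcases hA.lt_or_eq with hpos | h0
  · have key : (P - Hu) * (P * (Lb * Ho - P * HoLb) + Ho * (Lb * Hu - P * HuLb) -
        P * (HuHo * Lb - P * HuHoLb)) =
        P ^ 2 * ((Ho - HuHo) * (Lb - HuLb) - (HoLb - HuHoLb) * (P - Hu)) +
          (Lb * Hu - P * HuLb) * (HuHo * P - Ho * Hu) := by ring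
    have h1 : 0 ≤ P ^ 2 * ((Ho - HuHo) * (Lb - HuLb) - (HoLb - HuHoLb) * (P - Hu)) :=
      mul_nonneg (sq_nonneg P) (sub_nonneg.2 hstar)
    have h2 : 0 ≤ (Lb * Hu - P * HuLb) * (HuHo * P - Ho * Hu) :=
      mul_nonneg (sub_nonneg.2 hcross) (sub_nonneg.2 hH)
    by_contra hneg
    have hlt : P * (Lb * Ho - P * HoLb) + Ho * (Lb * Hu - P * HuLb) -
        P * (HuHo * Lb - P * HuHoLb) < 0 := not_le.1 hneg
    have h3 : (P - Hu) * (P * (Lb * Ho - P * HoLb) + Ho * (Lb * Hu - P * HuLb) -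
        P * (HuHo * Lb - P * HuHoLb)) < 0 := mul_neg_of_pos_of_neg hpos hlt
    linarith
  · have hHu : Hu = P := by linarith
    have hHuHo : HuHo = Ho := by linarith
    have hHuLb : HuLb = Lb := by linarith
    have hHuHoLb : HuHoLb = HoLb := by linarith
    have e : P * (Lb * Ho - P * HoLb) + Ho * (Lb * Hu - P * HuLb) -
        P * (HuHo * Lb - P * HuHoLb) = 0 := by
      rw [hHu, hHuHo, hHuLb, hHuHoLb]; ring
    rw [e]

end Algebra

/-! ## The events -/

section Sets

variable {V : Type*} {E : Type*} [DecidableEq V] (ends : E → Sym2 V)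

/-- The avoidance `{a₂ ↮ a₁, a₂ ↮ u}` is `Q ∩ {u ∉ C(a₂)}`. -/
lemma avoid_pair_eq_Q_inter (a₁ a₂ u : V) :
    avoidAll ends a₂ {a₁, u} = avoidAll ends a₂ {a₁} ∩ (connEvent ends a₂ u)ᶜ := by
  rw [SideBound.avoidAll_pair_eq ends a₂ a₁ u, SideBound.avoidAll_singleton_comm ends a₁ a₂]

/-- `X ∩ (Q ∩ huᶜ) = (Q ∩ X) ∩ huᶜ`. -/
lemma inter_Q_compl (X Q H : Set (Config E)) : X ∩ (Q ∩ Hᶜ) = (Q ∩ X) ∩ Hᶜ := by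
  ext ω; simp only [Set.mem_inter_iff, Set.mem_compl_iff]; tauto

/-- `(Q ∩ X) ∩ hu = Q ∩ (hu ∩ X)`. -/
lemma inter_Q_hu (X Q H : Set (Config E)) : (Q ∩ X) ∩ H = Q ∩ (H ∩ X) := by
  ext ω; simp only [Set.mem_inter_iff]; tauto

end Sets

/-! ## The masses of the avoidance `R = Q ∩ {u ∉ C(a₂)}` -/

section Masses

variable {V : Type*} {E : Type*} [Fintype E] [DecidableEq E] [DecidableEq V] {R : Type*}
  [Field R] [LinearOrder R] [IsStrictOrderedRing R]

/-- `P(Q ∩ X ∩ huᶜ) = P(Q ∩ X) − P(Q ∩ (hu ∩ X))`. -/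
lemma prob_R_mass (p : E → R) (Q H X : Set (Config E)) :
    prob p ((Q ∩ X) ∩ Hᶜ) = prob p (Q ∩ X) - prob p (Q ∩ (H ∩ X)) := by
  have h := prob_inter_add_prob_inter_compl p (Q ∩ X) H
  rw [inter_Q_hu] at h
  linarith

/-- The `R`-masses are nonnegative and at most `P(R)`. -/
lemma prob_R_mass_bounds (p : E → R) (hp : IsProbVec p) (Q H X : Set (Config E)) :
    0 ≤ prob p (Q ∩ X) - prob p (Q ∩ (H ∩ X)) ∧
      prob p (Q ∩ X) - prob p (Q ∩ (H ∩ X)) ≤ prob p Q - prob p (Q ∩ H) := by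
  have e1 := prob_R_mass p Q H X
  have e2 : prob p (Q ∩ Hᶜ) = prob p Q - prob p (Q ∩ H) := by
    have h := prob_inter_add_prob_inter_compl p Q H
    linarith
  refine ⟨by rw [← e1]; exact prob_nonneg hp _, ?_⟩
  rw [← e1, ← e2]
  exact prob_mono hp (Set.inter_subset_inter_left _ Set.inter_subset_left)

end Masses

/-! ## The theorem -/

section Main

variable {V : Type*} {E : Type*} [Fintype E] [DecidableEq E] [Fintype V] [DecidableEq V] {R : Type*}
  [Field R] [LinearOrder R] [IsStrictOrderedRing R]

/-- **BHK 1.4 with the avoided set `{a₁, u}`** (`s = a₂`), in the `Q`-vocabulary: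
`(HoLb − HuHoLb)·(P − Hu) ≤ (Ho − HuHo)·(Lb − HuLb)`. -/
lemma cross_avoid_u (p : E → R) (hp : IsProbVec p) (ends : E → Sym2 V) (o a₁ a₂ b u : V) :
    (prob p (avoidAll ends a₂ {a₁} ∩ (connEvent ends a₂ o ∩ connEvent ends a₁ b)) -
        prob p (avoidAll ends a₂ {a₁} ∩
          (connEvent ends a₂ u ∩ (connEvent ends a₂ o ∩ connEvent ends a₁ b)))) *
      (prob p (avoidAll ends a₂ {a₁}) - prob p (avoidAll ends a₂ {a₁} ∩ connEvent ends a₂ u)) ≤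
    (prob p (avoidAll ends a₂ {a₁} ∩ connEvent ends a₂ o) -
        prob p (avoidAll ends a₂ {a₁} ∩ (connEvent ends a₂ u ∩ connEvent ends a₂ o))) *
      (prob p (avoidAll ends a₂ {a₁} ∩ connEvent ends a₁ b) -
        prob p (avoidAll ends a₂ {a₁} ∩ (connEvent ends a₂ u ∩ connEvent ends a₁ b))) := by
  have h := bhk_cross_cluster_avoid p hp ends a₂ a₁ (X := {a₁, u})
    (Finset.mem_insert_self a₁ {u}) (isUpperSet_memFam o) (isUpperSet_memFam b)
  rw [clusterInEvent_memFam, clusterInEvent_memFam, avoid_pair_eq_Q_inter,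
    inter_Q_compl, inter_Q_compl, inter_Q_compl, prob_R_mass, prob_R_mass, prob_R_mass] at h
  have e : prob p (avoidAll ends a₂ {a₁} ∩ (connEvent ends a₂ u)ᶜ) =
      prob p (avoidAll ends a₂ {a₁}) - prob p (avoidAll ends a₂ {a₁} ∩ connEvent ends a₂ u) := by
    have h' := prob_inter_add_prob_inter_compl p (avoidAll ends a₂ {a₁}) (connEvent ends a₂ u)
    linarith
  rw [e] at h
  exact h

/-- **BHK 1.3, same cluster** (`s = a₂`), in the `Q`-vocabulary: `Ho·Hu ≤ HuHo·P`. -/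
lemma same_cluster_ou (p : E → R) (hp : IsProbVec p) (ends : E → Sym2 V) (o a₁ a₂ u : V) :
    prob p (avoidAll ends a₂ {a₁} ∩ connEvent ends a₂ o) *
        prob p (avoidAll ends a₂ {a₁} ∩ connEvent ends a₂ u) ≤
      prob p (avoidAll ends a₂ {a₁} ∩ (connEvent ends a₂ u ∩ connEvent ends a₂ o)) *
        prob p (avoidAll ends a₂ {a₁}) := by
  have h := SideBound.same_side_vdbk_mirror p hp ends u a₁ a₂ o
  rw [mul_comm (prob p (avoidAll ends a₂ {a₁} ∩ connEvent ends a₂ u))] at h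
  exact h

/-- **The cross-covariance of a product event** (M2-122): with the cleared masses
`P = P(Q)`, `Hu = P(Q, hu)`, `Ho = P(Q, ho)`, `Lb = P(Q, lb)`, `HoLb = P(Q, ho, lb)`, `HuLb = P(Q, hu, lb)`,
`HuHo = P(Q, hu, ho)`, `HuHoLb = P(Q, hu, ho, lb)`,
`0 ≤ P·(Lb·Ho − P·HoLb) + Ho·(Lb·Hu − P·HuLb) − P·(HuHo·Lb − P·HuHoLb)`, i.e.
`−Cov_Q(1_{u∈C₂}1_{o∈C₂}, 1_{b∈C₁}) ≤ −Cov_Q(1_{o∈C₂}, 1_{b∈C₁}) − P_Q(o ∈ C₂)·Cov_Q(1_{u∈C₂}, 1_{b∈C₁})`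
when `P(Q) > 0`. -/
theorem cross_product_bound (p : E → R) (hp : IsProbVec p) (ends : E → Sym2 V) (o a₁ a₂ b u : V) :
    0 ≤ prob p (avoidAll ends a₂ {a₁}) *
          (prob p (avoidAll ends a₂ {a₁} ∩ connEvent ends a₁ b) *
              prob p (avoidAll ends a₂ {a₁} ∩ connEvent ends a₂ o) -
            prob p (avoidAll ends a₂ {a₁}) *
              prob p (avoidAll ends a₂ {a₁} ∩ (connEvent ends a₂ o ∩ connEvent ends a₁ b))) +
        prob p (avoidAll ends a₂ {a₁} ∩ connEvent ends a₂ o) *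
          (prob p (avoidAll ends a₂ {a₁} ∩ connEvent ends a₁ b) *
              prob p (avoidAll ends a₂ {a₁} ∩ connEvent ends a₂ u) -
            prob p (avoidAll ends a₂ {a₁}) *
              prob p (avoidAll ends a₂ {a₁} ∩ (connEvent ends a₂ u ∩ connEvent ends a₁ b))) -
        prob p (avoidAll ends a₂ {a₁}) *
          (prob p (avoidAll ends a₂ {a₁} ∩ (connEvent ends a₂ u ∩ connEvent ends a₂ o)) *
              prob p (avoidAll ends a₂ {a₁} ∩ connEvent ends a₁ b) -
            prob p (avoidAll ends a₂ {a₁}) *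
              prob p (avoidAll ends a₂ {a₁} ∩
                (connEvent ends a₂ u ∩ (connEvent ends a₂ o ∩ connEvent ends a₁ b)))) := by
  have hA := prob_R_mass_bounds p hp (avoidAll ends a₂ {a₁}) (connEvent ends a₂ u) Set.univ
  simp only [Set.inter_univ] at hA
  have hB := prob_R_mass_bounds p hp (avoidAll ends a₂ {a₁}) (connEvent ends a₂ u)
    (connEvent ends a₂ o)
  have hC := prob_R_mass_bounds p hp (avoidAll ends a₂ {a₁}) (connEvent ends a₂ u)
    (connEvent ends a₁ b)
  have hD := prob_R_mass_bounds p hp (avoidAll ends a₂ {a₁}) (connEvent ends a₂ u)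
    (connEvent ends a₂ o ∩ connEvent ends a₁ b)
  have hstar := cross_avoid_u p hp ends o a₁ a₂ b u
  have hH := same_cluster_ou p hp ends o a₁ a₂ u
  have hcross := SideBound.cross_whole_mirror p hp ends u a₁ a₂ b
  rw [mul_comm, mul_comm (prob p (avoidAll ends a₂ {a₁} ∩ connEvent ends a₂ u))] at hcross
  exact key_ineq hA.1 hB.1 hB.2 hC.1 hC.2 hD.1 hD.2 hstar hH hcross

/-- **The mirror** (`a₁ ↔ a₂`; g55's candidate `(K1)` of M2-120): with `lv = {v ∈ C(a₁)}`,
`hb = {b ∈ C(a₂)}`, `0 ≤ P·(Hb·Lo − P·LoHb) + Lo·(Hb·Lu − P·LuHb) − P·(LuLo·Hb − P·LuLoHb)`, i.e.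
`−Cov_Q(1_{u∈C₁}1_{o∈C₁}, 1_{b∈C₂}) ≤ −Cov_Q(1_{o∈C₁}, 1_{b∈C₂}) − P_Q(o ∈ C₁)·Cov_Q(1_{u∈C₁}, 1_{b∈C₂})`. -/
theorem cross_product_bound_mirror (p : E → R) (hp : IsProbVec p) (ends : E → Sym2 V)
    (o a₁ a₂ b u : V) :
    0 ≤ prob p (avoidAll ends a₂ {a₁}) *
          (prob p (avoidAll ends a₂ {a₁} ∩ connEvent ends a₂ b) *
              prob p (avoidAll ends a₂ {a₁} ∩ connEvent ends a₁ o) -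
            prob p (avoidAll ends a₂ {a₁}) *
              prob p (avoidAll ends a₂ {a₁} ∩ (connEvent ends a₁ o ∩ connEvent ends a₂ b))) +
        prob p (avoidAll ends a₂ {a₁} ∩ connEvent ends a₁ o) *
          (prob p (avoidAll ends a₂ {a₁} ∩ connEvent ends a₂ b) *
              prob p (avoidAll ends a₂ {a₁} ∩ connEvent ends a₁ u) -
            prob p (avoidAll ends a₂ {a₁}) *
              prob p (avoidAll ends a₂ {a₁} ∩ (connEvent ends a₁ u ∩ connEvent ends a₂ b))) -
        prob p (avoidAll ends a₂ {a₁}) *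
          (prob p (avoidAll ends a₂ {a₁} ∩ (connEvent ends a₁ u ∩ connEvent ends a₁ o)) *
              prob p (avoidAll ends a₂ {a₁} ∩ connEvent ends a₂ b) -
            prob p (avoidAll ends a₂ {a₁}) *
              prob p (avoidAll ends a₂ {a₁} ∩
                (connEvent ends a₁ u ∩ (connEvent ends a₁ o ∩ connEvent ends a₂ b)))) := by
  have h := cross_product_bound p hp ends o a₂ a₁ b u
  rwa [SideBound.avoidAll_singleton_comm ends a₁ a₂] at h

end Main

end CrossProduct

end CovForm

end Summit.Ventures.PercRepro2
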